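import Summits.AtomisticToContinuum.HydrodynamicLimit.Theorems.CollisionIsometryCLTAdaptedWeightCLTBlockHDissipation

/-!
# Crux `AdaptedWeightCLT` (stmt-AtomisticToContinuum-14868, rev-12 time-local form): the SCALE SPLIT at the viscous
threshold — `CellKineticClosure → CellToBlockCoarsening → AdaptedWeightCLT` (pure logic, sorry-free)

Route `CollisionIsometryCLT`, sub-problem `HydrodynamicLimit`; crux-strategist seat
`planner-cstrat-stmt-AtomisticToContinuum-14868-s2-0`, 2026-08-17 (`--supports stmt-AtomisticToContinuum-14868`; a
CONDITIONAL certificate — it closes nothing by itself; it is the glue of a typed decomposition of the crux, D-0027 (b)).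

THE CUT. Every checked line on this crux (`sustained-anisotropy-superexp`, `kinetic-cell-epoch-ld`, `approach-cylinder-pullback`,
`block-h-dissipation-closure`; cards and triage in `Cruxes/AdaptedWeightCLT/`) splits the crux's block functional at an auxiliary
CELL scale below `L* = (N+1)^{-1/6}` and declares the same hydrodynamic remainder above it. `L*` is the VISCOUS THRESHOLD of the
hard-sphere gas in the crux's scaling (mean free path `≍ (N+1)^{-1/3}/σ²`, kinematic viscosity `ν ≍ (N+1)^{-1/3}/σ²` in macroscopic
units): a shear or sound mode of wavelength `(N+1)^{-γc}` is damped at rate `ν k² ≍ σ^{-2}(N+1)^{2γc - 1/3}`, which DIVERGES iff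
`γc > 1/6` and VANISHES iff `γc < 1/6`. Hence below `L*` (cells, `γc ∈ (1/6, 1/3)`: still `(N+1)^{1-3γc} → ∞` particles) no
sub-cell hydrodynamic mode survives a positive macroscopic time and flux-level local equilibrium is a purely KINETIC statement,
while between `L*` and the block scale `(N+1)^{-γ}`, `γ ≤ 1/15 < 1/6`, mesoscopic flow is INVISCID on the horizon (`t_visc → ∞`):
kinetic energy parked in sub-block shear is relaxed by no collision mechanism and is invisible to the `O(N)` entropy budget at
super-exponential precision (its Gibbs cost is `e^{-O(δN)}` only — the falsification of the gen-0 card `invariant-gibbs-superexp-transfer`).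
The two route items filed with this certificate are exactly the two sides of `L*`:

* `CellKineticClosure` (crux; THE KINETIC CORE): the crux's own statement with the kernel exponent range `0 < γ ≤ 1/15` replaced by
  `1/6 < γc < 1/3` — H1 (diffuse backward influence) and, per horizon, H2 (time-averaged exponential velocity moment) imply that the
  CELL traceless kinetic stress and kinetic heat flux vanish in `L²([0,t] × 𝕋³)` in probability, for every admissible cell family
  below the viscous threshold. In the landed vocabulary: `DiffuseAt → ∀ γc ∈ (1/6,1/3) ∀ admissible ψ, ∀ t > 0, TailsOn t →
  KineticClosureOn ψ t` (`cellKineticClosure_iff`, `Iff.rfl`). It is the common target of stubs S0–S5 of the live line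
  `block-h-dissipation-closure` (`cellKineticClosure_of_blockH` below: `FewCollisionsStub → EntropyBudgetStub → DVTransferStub →
  EntropyChaosRelStub → ContactToMassStub → EEPClosureStub → CellKineticClosure`, sorry-free), of the cell branch of
  `sustained-anisotropy-superexp` / `kinetic-cell-epoch-ld` (other cell functional) and of `approach-cylinder-pullback`'s host.
* `CellToBlockCoarsening` (crux; CELLS ⇒ BLOCKS ACROSS THE INVISCID BAND): for nice profiles, every `0 < σ < 1/2`, every
  `γc ∈ (1/6,1/3)`, every flow family, every admissible block family and every `t > 0` with H2: kinetic closure for ALL admissible cell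
  families at `γc` implies kinetic closure for the block family — the Germano identity (law of total covariance with smooth weights,
  provable) plus the SUB-BLOCK REYNOLDS REMAINDER (velocity quiescence in the inviscid band; MesoQuiescence-class pre-shock, the crux's
  own `∀ t > 0` exposure post-shock, Disproof F1, repair `C′ = PreShock` landed in `Negative/PreShockSuffices.lean`). VERBATIM the
  registered stub S6 `BlockHDissipation.CoarseningStub` up to currying of `NiceProfiles` (`cellToBlockCoarsening_iff_coarseningStub`).

`AdaptedWeightCLT_of_subs : CellKineticClosure → CellToBlockCoarsening → …Theses.CollisionIsometryCLT.AdaptedWeightCLT` is pure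
logic (`σ₀ := min σ₀(cell) 2⁻¹`, `γc := 1/4`, `adaptedWeightCLT_iff`, `cruxTailT_of_conclOn`, `conclOn_iff`). The two `def`s below are
byte-for-byte the one-line statements filed as the route items (so the route decls unfold to them).
-/

namespace Summit.AtomisticToContinuum.HydrodynamicLimit.Theorems.AdaptedWeightCLTSplit

open scoped BigOperators Topology Classical MeasureTheory ENNReal InnerProductSpace
open Filter Set MeasureTheory
open Literature.Analysis.FluidPDE
open Summit.AtomisticToContinuum.HydrodynamicLimit.Theorems.ContactSourceDuhamel (T3 V3 Cfg Flow Flows)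
open Summit.AtomisticToContinuum.HydrodynamicLimit.Theorems.ContactSourceDuhamel.TimeLocal
open Summit.AtomisticToContinuum.HydrodynamicLimit.Theorems.BlockHDissipation
open Literature.MathematicalPhysics.KineticTheory (hsDiameter localGibbsLaw)

noncomputable section

/-! ## The two children, verbatim as filed -/

/-- **Child 1 — `CellKineticClosure` (THE KINETIC CORE BELOW THE VISCOUS THRESHOLD).** The crux's text with the kernel
exponent clause `0 < γ → γ ≤ 1 / 15` replaced by `1 / 6 < γ → γ < 1 / 3` (cells of radius `(N+1)^{-γ}` between the
interparticle scale `(N+1)^{-1/3}` and the viscous threshold `(N+1)^{-1/6}`): for nice profiles there is `σ₀ > 0` such that for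
`0 < σ < σ₀` and every flow family, H1 (mean ipr of the frozen-geometry transfer `→ 0` on every kinetic window) implies, for every
such cell family and every `t > 0`, that H2 on `[0,t]` gives the vanishing in `L²([0,t] × 𝕋³)`-probability of the CELL traceless
kinetic stress and kinetic heat flux. -/
def CellKineticClosure : Prop :=
  ∀ (a₀ θ₀ : (UnitAddTorus (Fin 3)) → ℝ) (u₀ : (UnitAddTorus (Fin 3)) → (EuclideanSpace ℝ (Fin 3))), Continuous a₀ → Continuous θ₀ → Continuous u₀ → (∀ x, 0 < a₀ x) → (∀ x, 0 < θ₀ x) → ∃ σ₀ : ℝ, 0 < σ₀ ∧ ∀ σ : ℝ, 0 < σ → σ < σ₀ → let M := fun (N : ℕ) (y : Literature.Analysis.FluidPDE.Config (N + 1) (Fin 3) (UnitAddTorus (Fin 3))) (Δ : ℝ) (W : Fin (N + 1) → EuclideanSpace ℝ (Fin 3)) => (let G := Literature.Analysis.FluidPDE.Torus.geometry (Fin 3); let ε : ℝ := Literature.MathematicalPhysics.KineticTheory.hsDiameter σ N; let pre := fun k : ℕ => (let zk := Literature.Analysis.FluidPDE.Alexander.stateAfter G ε y k; Literature.Analysis.FluidPDE.freeFlight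 G (Literature.Analysis.FluidPDE.Alexander.freeExitTime G ε zk).toReal zk); (List.range (Literature.Analysis.FluidPDE.Alexander.collisionCount G ε y Δ)).foldl (fun W' k => @dite (Fin (N + 1) → EuclideanSpace ℝ (Fin 3)) (Literature.Analysis.FluidPDE.Alexander.incomingPairs G ε (pre k)).Nonempty (Classical.propDecidable _) (fun h => fun i => (Literature.Analysis.FluidPDE.collidePair G h.some.1 h.some.2 (fun j => ((pre k j).1, W' j)) i).2) (fun _ => W')) W); let ipr := fun N y Δ => ((N + 1 : ℕ) : ℝ)⁻¹ * ∑ i : Fin (N + 1), ∑ k : Fin (N + 1), (∑ a : Fin 3, ‖M N y Δ (Pi.single k (EuclideanSpace.single a (1 : ℝ))) i‖ ^ 2) ^ 2; ∀ Φ : (N : ℕ) → Literature.Analysis.FluidPDE.HardSphereFlow (Literature.Analysis.FluidPDE.Torus.geometry (Fin 3)) (Literature.MathematicalPhysics.KineticTheory.hsDiameter σ N) (N + 1), (∀ Δ : ℕ → ℝ, (∀ N, 0 < Δ N) → Tendsto Δ atTop (𝓝 0) → Tendsto (fun N : ℕ => Δ N * ((N + 1 : ℕ) : ℝ) ^ ((1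 : ℝ) / 3)) atTop atTop → ∀ t : ℝ, 0 < t → Tendsto (fun N : ℕ => ∫⁻ z, ENNReal.ofReal (ipr N ((Φ N).flow (t - Δ N) z) (Δ N)) ∂(Literature.MathematicalPhysics.KineticTheory.localGibbsLaw σ a₀ u₀ θ₀ N (Φ N))) atTop (𝓝 0)) → ∀ (γ C : ℝ) (φ : ℕ → (UnitAddTorus (Fin 3)) → ℝ), 1 / 6 < γ → γ < 1 / 3 → ((∀ N, Literature.Analysis.FunctionSpaces.Torus.IsSmooth (φ N)) ∧ (∀ N y, 0 ≤ φ N y) ∧ (∀ N, ∫ y, φ N y = 1) ∧ (∀ (N : ℕ) y, ((N : ℝ) + 1) ^ (-γ) ≤ Literature.Analysis.FluidPDE.Torus.euclidDist y 0 → φ N y = 0) ∧ (∀ (N : ℕ) y, φ N y ≤ C * ((N : ℝ) + 1) ^ (3 * γ)) ∧ (∀ (N : ℕ) y, ‖Literature.Analysis.FunctionSpaces.Torus.gradient (φ N) y‖ ≤ C * ((N : ℝ) + 1) ^ (4 * γ))) → let ρb := fun (N : ℕ) (s : ℝ) z (x : UnitAddTorus (Fin 3)) => Literature.MathematicalPhysics.KineticTheory.empiricalDensityField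 ((Φ N).flow s z) (fun y => φ N (y - x)); let mb := fun (N : ℕ) (s : ℝ) z (x : UnitAddTorus (Fin 3)) => Literature.MathematicalPhysics.KineticTheory.empiricalMomentumField ((Φ N).flow s z) (fun y => φ N (y - x)); let ub := fun (N : ℕ) (s : ℝ) z (x : UnitAddTorus (Fin 3)) => (ρb N s z x)⁻¹ • mb N s z x; let D := fun (N : ℕ) (s : ℝ) z (x : UnitAddTorus (Fin 3)) (j k : Fin 3) => (∫ y, φ N (y.1 - x) * ((y.2 j - ub N s z x j) * (y.2 k - ub N s z x k)) ∂(Literature.Analysis.FluidPDE.empiricalMeasure ((Φ N).flow s z))) - (if j = k then (∑ l : Fin 3, ∫ y, φ N (y.1 - x) * (y.2 l - ub N s z x l) ^ 2 ∂(Literature.Analysis.FluidPDE.empiricalMeasure ((Φ N).flow s z))) / 3 else 0); let q := fun (N : ℕ) (s : ℝ) z (x : UnitAddTorus (Fin 3)) => ∫ y, (φ N (y.1 - x) * ‖y.2 - ub N s z x‖ ^ 2 / 2) • (y.2 - ub N s z x) ∂(Literature.Analysis.FluidPDE.empiricalMeasure ((Φ N).flow s z)); ∀ t : ℝ, 0 <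 t → (∃ lam Cexp : ℝ, 0 < lam ∧ Tendsto (fun N : ℕ => Literature.MathematicalPhysics.KineticTheory.localGibbsLaw σ a₀ u₀ θ₀ N (Φ N) {z | Cexp < ∫ s in Icc 0 t, ∫ y, Real.exp (lam * ‖y.2‖ ^ 2) ∂(Literature.Analysis.FluidPDE.empiricalMeasure ((Φ N).flow s z))}) atTop (𝓝 0)) → ∀ δ : ℝ, 0 < δ → Tendsto (fun N : ℕ => Literature.MathematicalPhysics.KineticTheory.localGibbsLaw σ a₀ u₀ θ₀ N (Φ N) {z | δ < ∫ s in Icc 0 t, ∫ x, ((∑ j, ∑ k, D N s z x j k ^ 2) + ‖q N s z x‖ ^ 2)}) atTop (𝓝 0)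

/-- **Child 2 — `CellToBlockCoarsening` (CELLS ⇒ BLOCKS ACROSS THE INVISCID MESOSCOPIC BAND).** For nice profiles, every
`0 < σ < 1/2`, every `γc ∈ (1/6, 1/3)`, every flow family, every admissible block family (`0 < γ ≤ 1/15`) and every `t > 0` with H2
on `[0,t]`: kinetic closure on `[0,t]` for ALL admissible cell families at exponent `γc` implies kinetic closure on `[0,t]` for the
block family (Germano identity + sub-block Reynolds remainder). Verbatim `BlockHDissipation.CoarseningStub` with `NiceProfiles`
curried and the vocabulary inlined. -/
def CellToBlockCoarsening : Prop :=
  ∀ (a₀ θ₀ : (UnitAddTorus (Fin 3)) → ℝ) (u₀ : (UnitAddTorus (Fin 3)) → (EuclideanSpace ℝ (Fin 3))), Continuous a₀ → Continuous θ₀ → Continuous u₀ → (∀ x, 0 < a₀ x) → (∀ x, 0 < θ₀ x) → ∀ σ : ℝ, 0 < σ → σ < 2⁻¹ → ∀ γc : ℝ, 1 / 6 < γc → γc < 1 / 3 → ∀ Φ : (N : ℕ) → Literature.Analysis.FluidPDE.HardSphereFlow (Literature.Analysis.FluidPDE.Torus.geometry (Fin 3)) (Literature.MathematicalPhysics.KineticTheory.hsDiameter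 σ N) (N + 1), ∀ (γ C : ℝ) (φ : ℕ → (UnitAddTorus (Fin 3)) → ℝ), 0 < γ → γ ≤ 1 / 15 → ((∀ N, Literature.Analysis.FunctionSpaces.Torus.IsSmooth (φ N)) ∧ (∀ N y, 0 ≤ φ N y) ∧ (∀ N, ∫ y, φ N y = 1) ∧ (∀ (N : ℕ) y, ((N : ℝ) + 1) ^ (-γ) ≤ Literature.Analysis.FluidPDE.Torus.euclidDist y 0 → φ N y = 0) ∧ (∀ (N : ℕ) y, φ N y ≤ C * ((N : ℝ) + 1) ^ (3 * γ)) ∧ (∀ (N : ℕ) y, ‖Literature.Analysis.FunctionSpaces.Torus.gradient (φ N) y‖ ≤ C * ((N : ℝ) + 1) ^ (4 * γ))) → ∀ t : ℝ, 0 < t → (∃ lam Cexp : ℝ, 0 < lam ∧ Tendsto (fun N : ℕ => Literature.MathematicalPhysics.KineticTheory.localGibbsLaw σ a₀ u₀ θ₀ N (Φ N) {z | Cexp < ∫ s in Icc 0 t, ∫ y, Real.exp (lam * ‖y.2‖ ^ 2) ∂(Literature.Analysis.FluidPDE.empiricalMeasure ((Φ N).flow s z))}) atTop (𝓝 0)) →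 (∀ (C' : ℝ) (ψ : ℕ → (UnitAddTorus (Fin 3)) → ℝ), ((∀ N, Literature.Analysis.FunctionSpaces.Torus.IsSmooth (ψ N)) ∧ (∀ N y, 0 ≤ ψ N y) ∧ (∀ N, ∫ y, ψ N y = 1) ∧ (∀ (N : ℕ) y, ((N : ℝ) + 1) ^ (-γc) ≤ Literature.Analysis.FluidPDE.Torus.euclidDist y 0 → ψ N y = 0) ∧ (∀ (N : ℕ) y, ψ N y ≤ C' * ((N : ℝ) + 1) ^ (3 * γc)) ∧ (∀ (N : ℕ) y, ‖Literature.Analysis.FunctionSpaces.Torus.gradient (ψ N) y‖ ≤ C' * ((N : ℝ) + 1) ^ (4 * γc))) → let ρb := fun (N : ℕ) (s : ℝ) z (x : UnitAddTorus (Fin 3)) => Literature.MathematicalPhysics.KineticTheory.empiricalDensityField ((Φ N).flow s z) (fun y => ψ N (y - x)); let mb := fun (N : ℕ) (s : ℝ) z (x : UnitAddTorus (Fin 3)) => Literature.MathematicalPhysics.KineticTheory.empiricalMomentumField ((Φ N).flow s z) (fun y => ψ N (y - x)); let ub := fun (N : ℕ) (s : ℝ) z (x : UnitAddTorus (Fin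 3)) => (ρb N s z x)⁻¹ • mb N s z x; let D := fun (N : ℕ) (s : ℝ) z (x : UnitAddTorus (Fin 3)) (j k : Fin 3) => (∫ y, ψ N (y.1 - x) * ((y.2 j - ub N s z x j) * (y.2 k - ub N s z x k)) ∂(Literature.Analysis.FluidPDE.empiricalMeasure ((Φ N).flow s z))) - (if j = k then (∑ l : Fin 3, ∫ y, ψ N (y.1 - x) * (y.2 l - ub N s z x l) ^ 2 ∂(Literature.Analysis.FluidPDE.empiricalMeasure ((Φ N).flow s z))) / 3 else 0); let q := fun (N : ℕ) (s : ℝ) z (x : UnitAddTorus (Fin 3)) => ∫ y, (ψ N (y.1 - x) * ‖y.2 - ub N s z x‖ ^ 2 / 2) • (y.2 - ub N s z x) ∂(Literature.Analysis.FluidPDE.empiricalMeasure ((Φ N).flow s z)); ∀ δ : ℝ, 0 < δ → Tendsto (fun N : ℕ => Literature.MathematicalPhysics.KineticTheory.localGibbsLaw σ a₀ u₀ θ₀ N (Φ N) {z | δ < ∫ s in Icc 0 t, ∫ x, ((∑ j, ∑ k, D N s z x j k ^ 2) + ‖q N s z x‖ ^ 2)}) atTop (𝓝 0)) → let ρb :=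 fun (N : ℕ) (s : ℝ) z (x : UnitAddTorus (Fin 3)) => Literature.MathematicalPhysics.KineticTheory.empiricalDensityField ((Φ N).flow s z) (fun y => φ N (y - x)); let mb := fun (N : ℕ) (s : ℝ) z (x : UnitAddTorus (Fin 3)) => Literature.MathematicalPhysics.KineticTheory.empiricalMomentumField ((Φ N).flow s z) (fun y => φ N (y - x)); let ub := fun (N : ℕ) (s : ℝ) z (x : UnitAddTorus (Fin 3)) => (ρb N s z x)⁻¹ • mb N s z x; let D := fun (N : ℕ) (s : ℝ) z (x : UnitAddTorus (Fin 3)) (j k : Fin 3) => (∫ y, φ N (y.1 - x) * ((y.2 j - ub N s z x j) * (y.2 k - ub N s z x k)) ∂(Literature.Analysis.FluidPDE.empiricalMeasure ((Φ N).flow s z))) - (if j = k then (∑ l : Fin 3, ∫ y, φ N (y.1 - x) * (y.2 l - ub N s z x l) ^ 2 ∂(Literature.Analysis.FluidPDE.empiricalMeasure ((Φ N).flow s z))) / 3 else 0); let q := fun (N : ℕ) (s : ℝ) z (x : UnitAddTorus (Fin 3)) => ∫ y, (φ N (y.1 - x) * ‖y.2 - ub N s z x‖ ^ 2 / 2) •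 (y.2 - ub N s z x) ∂(Literature.Analysis.FluidPDE.empiricalMeasure ((Φ N).flow s z)); ∀ δ : ℝ, 0 < δ → Tendsto (fun N : ℕ => Literature.MathematicalPhysics.KineticTheory.localGibbsLaw σ a₀ u₀ θ₀ N (Φ N) {z | δ < ∫ s in Icc 0 t, ∫ x, ((∑ j, ∑ k, D N s z x j k ^ 2) + ‖q N s z x‖ ^ 2)}) atTop (𝓝 0)

/-! ## Read-back in the landed vocabulary (`Iff.rfl`: the inlined `let` telescopes are `iprF` / `KineticClosureOn` by ζδ-reduction) -/

/-- Child 1 in the vocabulary of `…TimeLocal` / `…BlockHDissipation`. -/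
theorem cellKineticClosure_iff :
    CellKineticClosure ↔
      ∀ (a₀ θ₀ : T3 → ℝ) (u₀ : T3 → V3), Continuous a₀ → Continuous θ₀ → Continuous u₀ →
        (∀ x, 0 < a₀ x) → (∀ x, 0 < θ₀ x) → ∃ σ₀ : ℝ, 0 < σ₀ ∧ ∀ σ : ℝ, 0 < σ → σ < σ₀ →
          ∀ Φ : Flows σ, DiffuseAt σ a₀ θ₀ u₀ Φ →
            ∀ (γc C' : ℝ) (ψ : ℕ → T3 → ℝ), 1 / 6 < γc → γc < 1 / 3 → AdmissibleKernel γc C' ψ →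
              ∀ t : ℝ, 0 < t → TailsOn σ a₀ θ₀ u₀ Φ t → KineticClosureOn σ a₀ θ₀ u₀ Φ ψ t :=
  Iff.rfl

/-- Child 2 in the vocabulary of `…TimeLocal` / `…BlockHDissipation`. -/
theorem cellToBlockCoarsening_iff :
    CellToBlockCoarsening ↔
      ∀ (a₀ θ₀ : T3 → ℝ) (u₀ : T3 → V3), Continuous a₀ → Continuous θ₀ → Continuous u₀ →
        (∀ x, 0 < a₀ x) → (∀ x, 0 < θ₀ x) → ∀ σ : ℝ, 0 < σ → σ < 2⁻¹ →
          ∀ γc : ℝ, 1 / 6 < γc → γc < 1 / 3 → ∀ Φ : Flows σ,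
            ∀ (γ C : ℝ) (φ : ℕ → T3 → ℝ), 0 < γ → γ ≤ 1 / 15 → AdmissibleKernel γ C φ →
              ∀ t : ℝ, 0 < t → TailsOn σ a₀ θ₀ u₀ Φ t →
                (∀ (C' : ℝ) (ψ : ℕ → T3 → ℝ), AdmissibleKernel γc C' ψ → KineticClosureOn σ a₀ θ₀ u₀ Φ ψ t) →
                  KineticClosureOn σ a₀ θ₀ u₀ Φ φ t :=
  Iff.rfl

/-- Child 2 IS the registered stub S6 of line `block-h-dissipation-closure` (`CoarseningStub`), up to currying `NiceProfiles`. -/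
theorem cellToBlockCoarsening_iff_coarseningStub : CellToBlockCoarsening ↔ CoarseningStub := by
  rw [cellToBlockCoarsening_iff]
  constructor
  · intro h a₀ θ₀ u₀ hn
    exact h a₀ θ₀ u₀ hn.1 hn.2.1 hn.2.2.1 hn.2.2.2.1 hn.2.2.2.2
  · intro h a₀ θ₀ u₀ ha hθ hu ha0 hθ0
    exact h a₀ θ₀ u₀ ⟨ha, hθ, hu, ha0, hθ0⟩

/-! ## The glue (pure logic) -/

/-- **THE SPLIT.** The two children give the crux `CollisionIsometryCLT.AdaptedWeightCLT` (rev-12, time-local) BY NAME: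
`σ₀ := min σ₀(CellKineticClosure) 2⁻¹`; per horizon `cruxTailT_of_conclOn` and `conclOn_iff`; the coarsening is applied at
`γc := 1/4 ∈ (1/6, 1/3)` to the cell closure supplied by child 1 for every admissible cell family at that exponent. -/
theorem AdaptedWeightCLT_of_subs (h₁ : CellKineticClosure) (h₂ : CellToBlockCoarsening) :
    Summit.AtomisticToContinuum.HydrodynamicLimit.Theses.CollisionIsometryCLT.AdaptedWeightCLT := by
  rw [adaptedWeightCLT_iff]
  rw [cellKineticClosure_iff] at h₁
  rw [cellToBlockCoarsening_iff] at h₂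
  intro a₀ θ₀ u₀ ha hθ hu ha0 hθ0
  obtain ⟨σ₀, hσ₀, H1⟩ := h₁ a₀ θ₀ u₀ ha hθ hu ha0 hθ0
  refine ⟨min σ₀ 2⁻¹, lt_min hσ₀ (by norm_num), fun σ hσ hσlt Φ hDiff => ?_⟩
  have hσ₀' : σ < σ₀ := lt_of_lt_of_le hσlt (min_le_left _ _)
  have hσ2 : σ < 2⁻¹ := lt_of_lt_of_le hσlt (min_le_right _ _)
  refine cruxTailT_of_conclOn fun t ht hT => ?_
  rw [conclOn_iff]
  intro γ C φ hγ hγ' hadm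
  have hγc1 : (1 : ℝ) / 6 < 1 / 4 := by norm_num
  have hγc2 : (1 : ℝ) / 4 < 1 / 3 := by norm_num
  exact h₂ a₀ θ₀ u₀ ha hθ hu ha0 hθ0 σ hσ hσ2 (1 / 4) hγc1 hγc2 Φ γ C φ hγ hγ' hadm t ht hT
    (fun C' ψ hψ => H1 σ hσ hσ₀' Φ hDiff (1 / 4) C' ψ hγc1 hγc2 hψ t ht hT)

/-- The same with the children in either order of strength: child 2 from the registered stub S6. -/
theorem cellToBlockCoarsening_of_coarseningStub (h : CoarseningStub) : CellToBlockCoarsening :=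
  cellToBlockCoarsening_iff_coarseningStub.2 h

/-! ## Child 1 from stubs S0–S5 of the live line `block-h-dissipation-closure` (its composition minus S6) -/

/-- Negative powers of `N + 1` tend to zero. -/
theorem tendsto_natSucc_rpow_neg' {e : ℝ} (he : e < 0) :
    Tendsto (fun N : ℕ => ((N + 1 : ℕ) : ℝ) ^ e) atTop (𝓝 0) := by
  have hcast : Tendsto (fun N : ℕ => ((N + 1 : ℕ) : ℝ)) atTop atTop :=
    tendsto_natCast_atTop_atTop.comp (tendsto_add_atTop_nat 1)
  have h := (tendsto_rpow_neg_atTop (by linarith : 0 < -e)).comp hcast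
  simpa [Function.comp_def, neg_neg] using h

/-- (Copied from the line skeleton `Cruxes/AdaptedWeightCLT/Lines/block_h_dissipation_closure.lean`, which is not importable — it carries the
registered `sorry` stubs.) DETERMINISTIC + PROBABILISTIC CORE of the block-h composition: the budget (`realDiss ≤ (N+1)^{γc+p}` w.h.p.) and the
one-sided chaos inequality (`realDiss + η (N+1)^{1/3} ≥ c₁ chaosDiss` w.h.p.) force `chaosDiss = o((N+1)^{1/3})`
in probability, because `γc + p < 1/3` for `p := (1/3 − γc)/2`. -/
theorem chaosSmall_of_oneSided_of_budget' {σ : ℝ} {a₀ θ₀ : T3 → ℝ} {u₀ : T3 → V3} {Φ : Flows σ}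
    {ψ : ℕ → T3 → ℝ} {γc h δ t : ℝ} (hγc : γc < 1 / 3)
    (hB : BudgetOn σ a₀ θ₀ u₀ Φ ψ γc h δ t) (hO : OneSidedOn σ a₀ θ₀ u₀ Φ ψ h δ t) :
    ChaosSmallOn σ a₀ θ₀ u₀ Φ ψ h δ t := by
  intro η hη
  obtain ⟨c₁, hc₁, hO⟩ := hO
  set p : ℝ := (1 / 3 - γc) / 2 with hp_def
  have hp : 0 < p := by rw [hp_def]; linarith
  have hexp : γc + p - 1 / 3 < 0 := by rw [hp_def]; linarith
  -- the two bad events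
  let EA : (N : ℕ) → Set (Cfg N) := fun N =>
    {z | ((N + 1 : ℕ) : ℝ) ^ (γc + p) < realDiss σ N (Φ N) ψ h δ t z}
  let EB : (N : ℕ) → Set (Cfg N) := fun N =>
    {z | realDiss σ N (Φ N) ψ h δ t z + (c₁ * η / 2) * ((N + 1 : ℕ) : ℝ) ^ ((1 : ℝ) / 3) <
      c₁ * chaosDiss σ N (Φ N) ψ h δ t z}
  have hA : Tendsto (fun N : ℕ => localGibbsLaw σ a₀ u₀ θ₀ N (Φ N) (EA N)) atTop (𝓝 0) := hB p hp
  have hBt : Tendsto (fun N : ℕ => localGibbsLaw σ a₀ u₀ θ₀ N (Φ N) (EB N)) atTop (𝓝 0) :=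
    hO (c₁ * η / 2) (by positivity)
  have hpos : ∀ N : ℕ, (0 : ℝ) < ((N + 1 : ℕ) : ℝ) := fun N => by exact_mod_cast Nat.succ_pos N
  -- eventually the margin closes: (N+1)^{γc+p} ≤ (c₁ η / 2) (N+1)^{1/3}
  have hmargin : ∀ᶠ N : ℕ in atTop,
      ((N + 1 : ℕ) : ℝ) ^ (γc + p) ≤ (c₁ * η / 2) * ((N + 1 : ℕ) : ℝ) ^ ((1 : ℝ) / 3) := by
    have hsmall : ∀ᶠ N : ℕ in atTop, ((N + 1 : ℕ) : ℝ) ^ (γc + p - 1 / 3) < c₁ * η / 2 :=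
      (tendsto_natSucc_rpow_neg' hexp).eventually (gt_mem_nhds (by positivity))
    filter_upwards [hsmall] with N hN
    have hN1 := hpos N
    have hsplit : ((N + 1 : ℕ) : ℝ) ^ (γc + p) =
        ((N + 1 : ℕ) : ℝ) ^ (γc + p - 1 / 3) * ((N + 1 : ℕ) : ℝ) ^ ((1 : ℝ) / 3) := by
      rw [← Real.rpow_add hN1]; congr 1; ring
    rw [hsplit]
    have h13 : 0 ≤ ((N + 1 : ℕ) : ℝ) ^ ((1 : ℝ) / 3) := (Real.rpow_pos_of_pos hN1 _).le
    exact mul_le_mul_of_nonneg_right hN.le h13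
  have hincl : ∀ᶠ N : ℕ in atTop,
      {z | η * ((N + 1 : ℕ) : ℝ) ^ ((1 : ℝ) / 3) < chaosDiss σ N (Φ N) ψ h δ t z} ⊆ EA N ∪ EB N := by
    filter_upwards [hmargin] with N hN z hz
    simp only [mem_setOf_eq] at hz
    by_contra hnot
    simp only [mem_union, mem_setOf_eq, not_or, not_lt, EA, EB] at hnot
    obtain ⟨hzA, hzB⟩ := hnot
    -- from ¬EB: c₁ chaosDiss ≤ realDiss + (c₁η/2) N^{1/3}; from ¬EA: realDiss ≤ N^{γc+p} ≤ (c₁η/2) N^{1/3}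
    have h1 : c₁ * (η * ((N + 1 : ℕ) : ℝ) ^ ((1 : ℝ) / 3)) < c₁ * chaosDiss σ N (Φ N) ψ h δ t z :=
      mul_lt_mul_of_pos_left hz hc₁
    nlinarith [hzA, hzB, hN, h1]
  have hle : ∀ᶠ N : ℕ in atTop, localGibbsLaw σ a₀ u₀ θ₀ N (Φ N)
      {z | η * ((N + 1 : ℕ) : ℝ) ^ ((1 : ℝ) / 3) < chaosDiss σ N (Φ N) ψ h δ t z} ≤
      localGibbsLaw σ a₀ u₀ θ₀ N (Φ N) (EA N) + localGibbsLaw σ a₀ u₀ θ₀ N (Φ N) (EB N) := by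
    filter_upwards [hincl] with N hN
    exact (measure_mono hN).trans (measure_union_le _ _)
  have hsum : Tendsto (fun N : ℕ => localGibbsLaw σ a₀ u₀ θ₀ N (Φ N) (EA N) +
      localGibbsLaw σ a₀ u₀ θ₀ N (Φ N) (EB N)) atTop (𝓝 0) := by
    simpa using hA.add hBt
  exact tendsto_of_tendsto_of_tendsto_of_le_of_le' tendsto_const_nhds hsum
    (Eventually.of_forall fun N => bot_le) hle

/-- **`CellKineticClosure` is exactly what S0–S5 of `block-h-dissipation-closure` deliver**: few collisions (S0), the exact
cell-entropy budget (S1), the Donsker–Varadhan transfer (S2), the relative entropic chaos residue (S3, which fixes `σ₀`), contact-to-mass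
via H1 (S4) and the EEP closure at fixed regularisation (S5) give kinetic closure for EVERY admissible cell family at EVERY
`γc ∈ (1/6, 1/3)` — the block step S6 is not used. (Proof: the live composition `BlockHDissipationClosure.AdaptedWeightCLT_of`
with its last line removed; `δ := min δ₀ 1 / 2`, `h := min h₀ 1 / 2`.) -/
theorem cellKineticClosure_of_blockH (h0 : FewCollisionsStub) (h1 : EntropyBudgetStub) (h2 : DVTransferStub)
    (h3 : EntropyChaosRelStub) (h4 : ContactToMassStub) (h5 : EEPClosureStub) : CellKineticClosure := by
  rw [cellKineticClosure_iff]
  intro a₀ θ₀ u₀ ha hθ hu ha0 hθ0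
  have hnice : NiceProfiles a₀ θ₀ u₀ := ⟨ha, hθ, hu, ha0, hθ0⟩
  obtain ⟨σ₀, hσ₀, H3⟩ := h3 a₀ θ₀ u₀ hnice
  refine ⟨min σ₀ 2⁻¹, lt_min hσ₀ (by norm_num), fun σ hσ hσlt Φ hDiff γc C' ψ hγc1 hγc2 hψ t ht hT => ?_⟩
  have hσ₀' : σ < σ₀ := lt_of_lt_of_le hσlt (min_le_left _ _)
  have hσ2 : σ < 2⁻¹ := lt_of_lt_of_le hσlt (min_le_right _ _)
  have HF : FewCollisionsOn σ a₀ θ₀ u₀ Φ t := h0 a₀ θ₀ u₀ hnice σ hσ hσ2 Φ t ht hT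
  obtain ⟨δ₀, hδ₀, h₀, hh₀, H2⟩ := h2 a₀ θ₀ u₀ hnice σ hσ hσ2 γc C' ψ hγc1 hγc2 hψ Φ t ht hT HF
  set δ : ℝ := min δ₀ 1 / 2 with hδ_def
  set h : ℝ := min h₀ 1 / 2 with hh_def
  have hδpos : 0 < δ := by rw [hδ_def]; positivity
  have hhpos : 0 < h := by rw [hh_def]; positivity
  have hδlt₀ : δ < δ₀ := by
    rw [hδ_def]; have := min_le_left δ₀ 1; linarith
  have hδlt1 : δ < 1 := by
    rw [hδ_def]; have := min_le_right δ₀ 1; linarith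
  have hhlt₀ : h < h₀ := by
    rw [hh_def]; have := min_le_left h₀ 1; linarith
  have hhlt1 : h < 1 := by
    rw [hh_def]; have := min_le_right h₀ 1; linarith
  have HR : EntropyChaosRelOn σ a₀ θ₀ u₀ Φ ψ γc h δ t :=
    H3 σ hσ hσ₀' γc C' ψ hγc1 hγc2 hψ h δ hhpos hhlt1 hδpos hδlt1 Φ hDiff t ht hT
  have HO : OneSidedOn σ a₀ θ₀ u₀ Φ ψ h δ t := H2 δ hδpos hδlt₀ h hhpos hhlt₀ HR
  have HB : BudgetOn σ a₀ θ₀ u₀ Φ ψ γc h δ t := budgetOn_of_decomp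
    (h1 a₀ θ₀ u₀ hnice σ hσ hσ2 γc C' ψ hγc1 hγc2 hψ h δ hhpos hhlt1 hδpos hδlt1 Φ t ht hT HF)
  have HC : ChaosSmallOn σ a₀ θ₀ u₀ Φ ψ h δ t := chaosSmall_of_oneSided_of_budget' hγc2 HB HO
  have HD : DissipSmallOn σ a₀ θ₀ u₀ Φ ψ h δ t :=
    h4 a₀ θ₀ u₀ hnice σ hσ hσ2 γc C' ψ hγc1 hγc2 hψ h δ hhpos hhlt1 hδpos hδlt1 Φ hDiff t ht hT HC
  exact h5 a₀ θ₀ u₀ hnice σ hσ hσ2 γc C' ψ hγc1 hγc2 hψ h δ hhpos hhlt1 hδpos hδlt1 Φ t ht hT HD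

/-- Registration anchor (`--supports stmt-AtomisticToContinuum-14868`): the decomposition certificate in its `∀`-closed form. -/
theorem adaptedWeightCLT_split_anchor : CellKineticClosure → CellToBlockCoarsening →
    Summit.AtomisticToContinuum.HydrodynamicLimit.Theses.CollisionIsometryCLT.AdaptedWeightCLT :=
  AdaptedWeightCLT_of_subs

/-- **The live line factors through the split**: the seven stub statements of `block-h-dissipation-closure` give the crux
THROUGH the two children (S0–S5 ⇒ `CellKineticClosure`, S6 ⇔ `CellToBlockCoarsening`, then `AdaptedWeightCLT_of_subs`) — the
same content as the skeleton's `BlockHDissipationClosure.AdaptedWeightCLT_of`, re-associated at the viscous threshold. -/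
theorem AdaptedWeightCLT_of_blockH_via_split (h0 : FewCollisionsStub) (h1 : EntropyBudgetStub) (h2 : DVTransferStub)
    (h3 : EntropyChaosRelStub) (h4 : ContactToMassStub) (h5 : EEPClosureStub) (h6 : CoarseningStub) :
    Summit.AtomisticToContinuum.HydrodynamicLimit.Theses.CollisionIsometryCLT.AdaptedWeightCLT :=
  AdaptedWeightCLT_of_subs (cellKineticClosure_of_blockH h0 h1 h2 h3 h4 h5) (cellToBlockCoarsening_of_coarseningStub h6)

end

end Summit.AtomisticToContinuum.HydrodynamicLimit.Theorems.AdaptedWeightCLTSplit
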